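import Mathlib

/-!
# `KickNegentropyBound` (card label-group-clausius-audit, IdeatorThreeSketch.lean) is FALSE as typed

Crux-triage r1 k=1, stmt-AtomisticToContinuum-13081.  Mathlib's `klDiv μ ν` is `ℝ≥0∞`-valued:
`klDiv μ ν = ENNReal.ofReal (∫ llr μ ν ∂μ + ν.real univ - μ.real univ)` (if `μ ≪ ν` and `llr` is
integrable, else `∞`).  For an INFINITE σ-finite reference `ν.real univ = (∞).toReal = 0` and the
`ofReal` truncation at `0` destroys the intended signed inequality
`D((kick P)_X ‖ μ) + D(P_Y ‖ ν) ≤ D(P ‖ μ ⊗ ν)`.  Witness: `X = ℕ`, `μ = count`, `Y = Unit`,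
`ν = 3 • dirac ()`, `P = dirac (0, ())`, `T = id`:  LHS `≥ klDiv (dirac ()) (3 • dirac ()) =
ofReal (2 - log 3) > 0`, RHS `= klDiv P (count ⊗ ν) = ofReal (-log 3 + 0 - 1) = 0`.
Repair (for the crux-plan): probability/finite references with the mass terms, or the signed
differential-entropy form `∫ llr ((kick P).fst) μ ∂(kick P).fst ≤ ∫ llr P.fst μ ∂P.fst + I(P)`
under `≪`/integrability hypotheses; the tree lemma `klDiv_map_fst_add_klDiv_map_snd_le` the card
leans on is stated for PROBABILITY references only.
-/

open MeasureTheory InformationTheory Set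
open scoped ENNReal

namespace KickJunk

/-- Verbatim copy of `KickNegentropyBound` from `Cruxes/LocalSecondLaw/IdeatorThreeSketch.lean`. -/
def KickNegentropyBound : Prop :=
  ∀ (X Y : Type) [MeasurableSpace X] [MeasurableSpace Y]
    (μ : Measure X) (ν : Measure Y) [SigmaFinite μ] [SigmaFinite ν]
    (P : Measure (X × Y)) [IsProbabilityMeasure P]
    (T : Y → X → X), Measurable (fun p : X × Y => (T p.2 p.1, p.2)) →
    (∀ y, MeasurePreserving (T y) μ μ) →
    InformationTheory.klDiv ((P.map fun p : X × Y => (T p.2 p.1, p.2)).fst) μ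
        + InformationTheory.klDiv P.snd ν
      ≤ InformationTheory.klDiv P (μ.prod ν)

/-- The Radon–Nikodym derivative at an atom of the reference measure. -/
theorem rnDeriv_apply_of_atom {α : Type*} [MeasurableSpace α] [MeasurableSingletonClass α]
    (μ ν : Measure α) [SigmaFinite μ] [SigmaFinite ν] (hac : μ ≪ ν) (a : α)
    (h0 : ν {a} ≠ 0) (htop : ν {a} ≠ ∞) :
    μ.rnDeriv ν a = μ {a} / ν {a} := by
  have h := Measure.withDensity_rnDeriv_eq μ ν hac
  have h1 : ν.withDensity (μ.rnDeriv ν) {a} = μ {a} := by rw [h]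
  rw [withDensity_apply _ (measurableSet_singleton a), lintegral_singleton] at h1
  rw [ENNReal.eq_div_iff h0 htop, mul_comm]
  exact h1

theorem not_KickNegentropyBound : ¬ KickNegentropyBound := by
  intro h
  set ν : Measure Unit := (3 : ℝ≥0∞) • Measure.dirac () with hν
  have hν1 : ν {()} = 3 := by simp [hν]
  have hνuniv : ν univ = 3 := by simp [hν]
  haveI hνfin : IsFiniteMeasure ν := ⟨by simp [hνuniv]⟩
  set P : Measure (ℕ × Unit) := Measure.dirac ((0 : ℕ), ()) with hP
  haveI : IsProbabilityMeasure P := by rw [hP]; infer_instance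
  have hT : Measurable (fun p : ℕ × Unit => ((fun (_ : Unit) (x : ℕ) => x) p.2 p.1, p.2)) :=
    measurable_id
  have key := h ℕ Unit Measure.count ν P (fun _ x => x) hT (fun _ => MeasurePreserving.id _)
  have hmap : (P.map fun p : ℕ × Unit => ((fun (_ : Unit) (x : ℕ) => x) p.2 p.1, p.2)) = P :=
    Measure.map_id
  rw [hmap] at key
  -- the `Y`-marginal of `P`
  have hsnd : P.snd = Measure.dirac () := by
    simp only [Measure.snd, hP]
    rw [Measure.map_dirac' measurable_snd]
  -- `klDiv (dirac ()) ν = ofReal (2 - log 3)`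
  have hac2 : Measure.dirac () ≪ ν := by
    rw [hν]; exact Measure.absolutelyContinuous_smul (by norm_num)
  have hrn2 : (Measure.dirac ()).rnDeriv ν () = 3⁻¹ := by
    rw [rnDeriv_apply_of_atom _ _ hac2 () (by simp [hν1]) (by simp [hν1]), hν1]
    simp
  have hllr2 : llr (Measure.dirac ()) ν () = -Real.log 3 := by
    simp [llr, hrn2]
  have hkl2 : klDiv (Measure.dirac ()) ν = ENNReal.ofReal (2 - Real.log 3) := by
    rw [klDiv_of_ac_of_integrable hac2 (integrable_dirac (by simp)), integral_dirac, hllr2]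
    congr 1
    simp [measureReal_def, hνuniv]
    ring
  -- `klDiv P (count ⊗ ν) = 0`
  set R : Measure (ℕ × Unit) := Measure.count.prod ν with hR
  have hRa : R {((0 : ℕ), ())} = 3 := by
    rw [hR, ← Set.singleton_prod_singleton, Measure.prod_prod, Measure.count_singleton, hν1, one_mul]
  have hRuniv : R univ = ∞ := by
    rw [hR, ← Set.univ_prod_univ, Measure.prod_prod, Measure.count_apply_infinite Set.infinite_univ,
      hνuniv]
    simp
  have hacP : P ≪ R := by
    refine Measure.AbsolutelyContinuous.mk fun s hs h0 => ?_
    have hnot : ((0 : ℕ), ()) ∉ s := by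
      intro hmem
      have hle : R {((0 : ℕ), ())} ≤ R s := measure_mono (Set.singleton_subset_iff.mpr hmem)
      rw [hRa, h0] at hle
      exact absurd hle (by norm_num)
    rw [hP, Measure.dirac_apply' _ hs, Set.indicator_of_notMem hnot]
  have hrnP : P.rnDeriv R ((0 : ℕ), ()) = 3⁻¹ := by
    rw [rnDeriv_apply_of_atom _ _ hacP _ (by simp [hRa]) (by simp [hRa]), hRa]
    simp [hP]
  have hllrP : llr P R ((0 : ℕ), ()) = -Real.log 3 := by
    simp [llr, hrnP]
  have hlog3 : 0 < Real.log 3 := Real.log_pos (by norm_num)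
  have hklP : klDiv P R = 0 := by
    rw [klDiv_of_ac_of_integrable hacP (integrable_dirac (by simp))]
    have hint : ∫ x, llr P R x ∂P = -Real.log 3 := by
      rw [hP, integral_dirac]
      rw [← hP]
      exact hllrP
    rw [hint]
    apply ENNReal.ofReal_eq_zero.mpr
    have h1 : R.real univ = 0 := by simp [measureReal_def, hRuniv]
    have h2 : P.real univ = 1 := by simp [measureReal_def]
    rw [h1, h2]
    linarith
  -- conclude: `ofReal (2 - log 3) ≤ 0` is absurd since `log 3 < 2`
  rw [hsnd, hkl2, hklP] at key
  have h23 : Real.log 3 < 2 := by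
    have := Real.log_lt_sub_one_of_pos (x := 3) (by norm_num) (by norm_num)
    linarith
  have hpos : 0 < ENNReal.ofReal (2 - Real.log 3) := ENNReal.ofReal_pos.mpr (by linarith)
  have hle : ENNReal.ofReal (2 - Real.log 3) ≤ 0 := le_trans le_add_self key
  exact absurd (lt_of_lt_of_le hpos hle) (lt_irrefl _)

end KickJunk
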